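import Literature.MathematicalPhysics.QuantumLattice.GrassmannIntegralGaussianProofs
import Mathlib.LinearAlgebra.Matrix.Block
import Mathlib.LinearAlgebra.Determinant
import HarnessLib

/-!
# Linear substitutions in the Berezin integral (the fermionic Jacobian)

Trunk **QLatticeAQFT**; companion of `GrassmannIntegral.lean` (Berezin integral `berezin R J`,
monomial basis `grassmannBasis`, generators `gen`).  A linear map `f` of the generator space
`J → R` induces the algebra endomorphism `ExteriorAlgebra.map f` of the Grassmann algebra
`GrassmannAlgebra R J = ⋀(J → R)`, i.e. the linear substitution of generators
`θⱼ ↦ Σᵢ f(eⱼ)ᵢ θᵢ` (`map_gen`).  Main results (all `theorem`s, no definitions or named facts):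

* `GrassmannAlgebra.berezin_map` — **Berezin's change-of-variables formula**:
  `berezin (map f x) = det f · berezin x` for every `x` (the fermionic "Jacobian" is `det f`,
  entering with the power opposite to the bosonic substitution rule);
* `GrassmannAlgebra.berezin_map_of_det_eq_one` — invariance under unimodular substitutions;
* `GrassmannAlgebra.det_one_add_eq_one_of_shift`, `GrassmannAlgebra.berezin_map_one_add_shift` —
  **translation invariance**: shifting the generators outside a set `T` by linear combinations
  of the generators in `T` (substitution `1 + N`, `N(e_T) = 0`, `N(e_j) ∈ span e_T`) has unit
  Jacobian and leaves the Berezin integral over all generators unchanged;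
* `GrassmannAlgebra.map_grassmannExp` — substitution commutes with `exp`;
* bookkeeping: `ι_eq_sum_gen`, `map_gen`, `grassmannBasis_mem_exteriorPower`,
  `grassmannBasis_univ_eq_ιMulti` (the top monomial as `ιMulti` along `Fin n ≃o J`).

## Sources

F. A. Berezin, *The Method of Second Quantization* (Academic Press, 1966), Ch. I §3 (integration
on a Grassmann algebra; behaviour of the integral under linear changes of the generators), bib key
`BerezinSecondQuant1966` (not held locally; statement as used in the secondary sources below).
M. Salmhofer, *Renormalization: An Introduction* (Springer, 1999), App. B.2, PDF p. 176 of the held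
copy `book:salmhofer1999-renormalization-introduction`: linear change of generators (B.23)–(B.25),
Lemma B.1 "`∫ dψ₁ F(ψ₁ - αη₁, ψ₂, …, ψ_N) = ∫ dψ₁ F(ψ₁, ψ₂, …, ψ_N)`" (B.29) and Corollary B.2
"`∫ ∏ dψ̄ₖ dψₖ f(ψ̄ + Aη̄, ψ + Bη) = ∫ ∏ dψ̄ₖ dψₖ f(ψ̄, ψ)`" (B.30), bib key `Salmhofer1999`.
The translation invariance proved here is the form of Cor. B.2 integrated over all generators
(spectators `η` included); the partial-integration form needs `berezinOn` and is not treated.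
These substitution rules are the input of the "completion of the square" proof of the Gaussian
generating functional (Salmhofer Lemma B.6) and of the symmetry arguments for Grassmann Gaussian
integrations (e.g. Benfatto–Giuliani–Mastropietro 2006, §2.1, symmetries (1)–(5) of `P(dψ)`).

## Proof of `berezin_map`

Both sides are linear in `x`; check on the monomial basis `θ_s`.  `map f` sends
`θ_s = ιMulti (e_{s})` to `ιMulti (f ∘ e_s) ∈ ⋀^{#s}`, so for `s ≠ univ` both sides vanish
(`berezin_eq_zero_of_mem_exteriorPower`).  For `s = univ`, `berezin (ιMulti (f eᵢ)ᵢ)` is the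
determinant of the coordinate matrix `(f e_p)(e_q)` (`berezin_ιMulti`), which is
`(toMatrix' f)ᵀ` reindexed along `Fin n ≃o J`, of determinant `det f`.  For the shift,
`toMatrix (1 + N)` is block unitriangular for the partition `T ⊔ Tᶜ`
(`Matrix.BlockTriangular.det`).
-/

noncomputable section

namespace Literature.MathematicalPhysics.QuantumLattice

section QLatticeAQFT

namespace GrassmannAlgebra

open ExteriorAlgebra

variable (R : Type*) [CommRing R] {J : Type*}

/-- A degree-one element is a linear combination of generators: `ι v = Σᵢ vᵢ θᵢ`. [folklore] -/
theorem ι_eq_sum_gen [Fintype J] [DecidableEq J] (v : J → R) :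
    ExteriorAlgebra.ι R v = ∑ i, v i • gen R i := by
  have hv : v = ∑ i, v i • (Pi.single i (1 : R) : J → R) := by
    ext j
    simp [Finset.sum_apply, Pi.single_apply]
  conv_lhs => rw [hv]
  simp only [map_sum, map_smul, gen]

/-- The algebra endomorphism `ExteriorAlgebra.map f` induced by a linear map `f` of the generator
space is the linear substitution of generators `θⱼ ↦ Σᵢ f(eⱼ)ᵢ θᵢ` (Berezin 1966, Ch. I §3;
Salmhofer 1999, (B.23)). [folklore] -/
theorem map_gen [Fintype J] [DecidableEq J] (f : (J → R) →ₗ[R] (J → R)) (j : J) :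
    ExteriorAlgebra.map f (gen R j) = ∑ i, f (Pi.single j 1) i • gen R i := by
  rw [gen, ExteriorAlgebra.map_apply_ι, ι_eq_sum_gen]

/-- Substitution commutes with the (nilpotent) exponential. [folklore] -/
theorem map_grassmannExp [Algebra ℚ R] (f : (J → R) →ₗ[R] (J → R)) {a : GrassmannAlgebra R J}
    (ha : IsNilpotent a) : ExteriorAlgebra.map f (grassmannExp a) = grassmannExp (ExteriorAlgebra.map f a) :=
  IsNilpotent.map_exp ha _

variable [LinearOrder J] [Fintype J]

/-- Every monomial basis element `θ_s` lies in the homogeneous component `⋀^{#s}`. [folklore] -/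
theorem grassmannBasis_mem_exteriorPower (s : Finset J) :
    grassmannBasis R J s ∈ ⋀[R]^s.card (J → R) := by
  rw [grassmannBasis, ExteriorAlgebra.basis_apply]
  exact ιMulti_range R _ (Set.mem_range_self _)

/-- The top monomial `θ_{univ}` is the increasing product of all generators along the order
isomorphism `Fin n ≃o J`. [folklore] -/
theorem grassmannBasis_univ_eq_ιMulti :
    grassmannBasis R J Finset.univ = ιMulti R (Fintype.card J)
      fun p => (Pi.single (Fintype.orderIsoFinOfCardEq J rfl p) (1 : R) : J → R) := by
  have hcard : (Finset.univ : Finset J).card = Fintype.card J := Finset.card_univ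
  have h1 := Finset.orderEmbOfFin_unique hcard
    (fun x => Finset.mem_univ ((Set.powersetCard.ofFinEmbEquiv.symm
      (Set.powersetCard.ofCard hcard)) x)) (OrderEmbedding.strictMono _)
  have h2 := Finset.orderEmbOfFin_unique hcard
    (fun x => Finset.mem_univ (Fintype.orderIsoFinOfCardEq J rfl x))
    (Fintype.orderIsoFinOfCardEq J rfl).strictMono
  rw [grassmannBasis, ExteriorAlgebra.basis_apply_ofCard (Pi.basisFun R J) hcard]
  simp only [ιMulti_family]
  congr 1
  funext p
  simp only [Function.comp_apply, Pi.basisFun_apply]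
  rw [show (Set.powersetCard.ofFinEmbEquiv.symm (Set.powersetCard.ofCard hcard)) p =
      Fintype.orderIsoFinOfCardEq J rfl p from (congrFun h1 p).trans (congrFun h2 p).symm]

/-- **Linear change of variables in the Berezin integral** (Berezin 1966, Ch. I §3; Salmhofer
1999, App. B.2, (B.23)–(B.25)): under the substitution of generators `θⱼ ↦ Σᵢ Fᵢⱼ θᵢ` induced by a
linear map `f` of the generator space (matrix `F`), the Berezin integral is multiplied by the
Jacobian `det f`: `∫ dθ (F(fθ)) = det f · ∫ dθ F(θ)` — the fermionic Jacobian enters with the power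
opposite to the bosonic one. Proof: `map f` preserves the grading, and on the top monomial
`θ₁⋯θₙ ↦ (fθ)₁⋯(fθ)ₙ` the top coefficient is `det f` (`berezin_ιMulti`). [cite: BerezinSecondQuant1966, Ch. I §3] -/
theorem berezin_map (f : (J → R) →ₗ[R] (J → R)) (x : GrassmannAlgebra R J) :
    berezin R J (ExteriorAlgebra.map f x) = LinearMap.det f * berezin R J x := by
  suffices h : (berezin R J) ∘ₗ (ExteriorAlgebra.map f).toLinearMap = LinearMap.det f • berezin R J from
    LinearMap.congr_fun h x
  refine (grassmannBasis R J).ext fun s => ?_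
  rw [LinearMap.comp_apply, AlgHom.toLinearMap_apply, LinearMap.smul_apply, smul_eq_mul]
  by_cases hs : s = Finset.univ
  · subst hs
    set c : Fin (Fintype.card J) ≃o J := Fintype.orderIsoFinOfCardEq J rfl with hc
    rw [berezin_grassmannBasis_univ, mul_one, grassmannBasis_univ_eq_ιMulti,
      ExteriorAlgebra.map_apply_ιMulti, berezin_ιMulti R rfl c.strictMono, ← LinearMap.det_toMatrix',
      ← Matrix.det_transpose (LinearMap.toMatrix' f), ← Matrix.det_submatrix_equiv_self c.toEquiv]
    congr 1
  · have hne : s.card ≠ Fintype.card J := fun h => hs (Finset.eq_univ_of_card s h)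
    rw [berezin_grassmannBasis_of_ne R hs, mul_zero, grassmannBasis, ExteriorAlgebra.basis_apply]
    simp only [ιMulti_family, ExteriorAlgebra.map_apply_ιMulti]
    exact berezin_eq_zero_of_mem_exteriorPower R hne (ιMulti_range R _ (Set.mem_range_self _))

/-- Substitutions with unit Jacobian (`det f = 1`, e.g. `SL`-rotations of the generators) leave
the Berezin integral invariant. [folklore] -/
theorem berezin_map_of_det_eq_one {f : (J → R) →ₗ[R] (J → R)} (hf : LinearMap.det f = 1)
    (x : GrassmannAlgebra R J) : berezin R J (ExteriorAlgebra.map f x) = berezin R J x := by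
  rw [berezin_map, hf, one_mul]

/-- A "shift" endomorphism — `N` kills the generators indexed by `T` and maps every generator into
their span — is square-zero-like and `1 + N` has determinant `1` (block unitriangular). [folklore] -/
theorem det_one_add_eq_one_of_shift (N : Module.End R (J → R)) (T : Finset J)
    (h₁ : ∀ j ∈ T, N (Pi.single j 1) = 0) (h₂ : ∀ j i, i ∉ T → N (Pi.single j 1) i = 0) :
    LinearMap.det (1 + N) = 1 := by
  rw [← LinearMap.det_toMatrix (Pi.basisFun R J)]
  set M := LinearMap.toMatrix (Pi.basisFun R J) (Pi.basisFun R J) (1 + N) with hMdef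
  have hM : ∀ i j, M i j = (if i = j then 1 else 0) + N (Pi.single j 1) i := by
    intro i j
    rw [hMdef, LinearMap.toMatrix_apply, Pi.basisFun_repr, Pi.basisFun_apply, LinearMap.add_apply,
      Pi.add_apply, Module.End.one_apply, Pi.single_apply]
  -- `N (e_j) i = 0` unless `i ∈ T` and `j ∉ T`
  have hN : ∀ i j, (i ∈ T ↔ j ∈ T) → N (Pi.single j 1) i = 0 := by
    intro i j hij
    by_cases hj : j ∈ T
    · rw [h₁ j hj, Pi.zero_apply]
    · exact h₂ j i (fun hi => hj (hij.1 hi))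
  let b : J → ℕ := fun i => if i ∈ T then 0 else 1
  have hb : ∀ i j, b i = b j → (i ∈ T ↔ j ∈ T) := by
    intro i j h
    by_cases hi : i ∈ T <;> by_cases hj : j ∈ T <;> simp_all [b]
  have hBT : M.BlockTriangular b := by
    intro i j hij
    have hj : j ∈ T := by
      by_contra hj
      have : b j = 1 := if_neg hj
      have hbi : b i ≤ 1 := by dsimp only [b]; split_ifs <;> omega
      omega
    have hi : i ∉ T := by
      intro hi
      have : b i = 0 := if_pos hi
      omega
    have hne : i ≠ j := fun h => hi (h ▸ hj)
    rw [hM, if_neg hne, zero_add, h₁ j hj, Pi.zero_apply]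
  rw [hBT.det]
  refine Finset.prod_eq_one fun k _ => ?_
  have hblock : M.toSquareBlock b k = 1 := by
    ext i j
    obtain ⟨i, hi⟩ := i
    obtain ⟨j, hj⟩ := j
    rw [Matrix.toSquareBlock_def, Matrix.of_apply, hM, hN i j (hb i j (hi.trans hj.symm)), add_zero,
      Matrix.one_apply]
    simp only [Subtype.mk.injEq]
  rw [hblock, Matrix.det_one]

/-- **Translation invariance of the Berezin integral** (Salmhofer 1999, Lemma B.1 and Cor. B.2:
`∫ dψ₁ F(ψ₁ - αη₁, ψ₂, …) = ∫ dψ₁ F(ψ₁, ψ₂, …)`,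
`∫ ∏ dψ̄ₖdψₖ f(ψ̄ + Aη̄, ψ + Bη) = ∫ ∏ dψ̄ₖdψₖ f(ψ̄, ψ)`): shifting the integration variables
(generators outside `T`) by linear combinations of the remaining generators `T` (a substitution
`1 + N` with `N` as in `det_one_add_eq_one_of_shift`) does not change the integral over all
generators. [cite: Salmhofer1999, App. B Lemma B.1] -/
theorem berezin_map_one_add_shift (N : Module.End R (J → R)) (T : Finset J)
    (h₁ : ∀ j ∈ T, N (Pi.single j 1) = 0) (h₂ : ∀ j i, i ∉ T → N (Pi.single j 1) i = 0)
    (x : GrassmannAlgebra R J) :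
    berezin R J (ExteriorAlgebra.map (1 + N) x) = berezin R J x :=
  berezin_map_of_det_eq_one R (det_one_add_eq_one_of_shift R N T h₁ h₂) x

end GrassmannAlgebra

end QLatticeAQFT

end Literature.MathematicalPhysics.QuantumLattice
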